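import Summits.BirchSwinnertonDyer.BirchSwinnertonDyer.Theorems.ManinLocalTwoThreeEtaUnitCubeThird
import Summits.BirchSwinnertonDyer.BirchSwinnertonDyer.Theorems.ManinLocalTwoThreeEtaUnitSquareOdd
import Mathlib.FieldTheory.Finite.Basic
import HarnessLib

/-!
# `η`-unit series that are `3`-adic cubes have exponents `≡ 0 (mod 3)` at the scales PRIME TO `3` (half of E-an-56)

Summit `BirchSwinnertonDyer`, route `ManinLocalTwoThree` (cell bsd-f2-manin), crux C3 `ManinPrimeToThreeAtNine`
(stmt-BirchSwinnertonDyer-22968), the `W[3]`-reducible residual; an g14's cuspidal-Kummer CUBE certificate (MEMO-an §56.12), support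
theorem **E-an-56 `EtaUnitCubeIffThree`** («for `0 ∉ S`, the unit series `g ∈ 1 + qℤ⟦q⟧` of `∏_δ E(q^δ)^{r_δ}` is a cube in `ℤ₃⟦q⟧`
iff all `r_δ ≡ 0 (mod 3)`»).  This file is the `p = 3` twin of `…EtaUnitSquareOdd.lean` and proves the half of `⇒` at the scales
prime to `3` (MEMO-an §56.12, first case):

* `coeff_eq_zero_of_isCube_of_not_three_dvd` — cubes in `𝔽₃⟦q⟧` live in `𝔽₃⟦q³⟧` (truncate to a polynomial and use
  `f³ = expand 3 f` over `𝔽₃`, `ZMod.expand_card`);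
* **`three_dvd_of_isCube_etaUnit_of_not_three_dvd`** — if `g` is a `3`-adic cube then `3 ∣ r_δ` for every `δ ∈ S` with `3 ∤ δ`.

Route: reduce mod `3`; if `δ₀` is the least `δ` prime to `3` with `3 ∤ r_δ`, the functional `c = coeff δ₀` is ADDITIVE on products of
series with constant term `1` whose coefficients vanish in the degrees `< δ₀` prime to `3` (`coeff_prod_of_vanishThreeBelow`), every
factor `E(q^δ)^{|r_δ|}` of the identity `g·∏_{r<0} = ∏_{r>0}` is such a series, and `c` of the two sides differ by
`± |r_{δ₀}|·c(E(q^{δ₀})) = ∓ |r_{δ₀}| ≢ 0 (mod 3)` — contradiction (`E(q^δ) = 1 − q^δ + O(q^{2δ})`, tree `coeff_formalEulerScaled`).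
The hypothesis is `IsEtaUnitSeries S r g` unfolded.

No new definitions; nothing about BSD or Manin's conjecture is proved here.

References: cell memo HOME/MEMO-an.md §56.12; T. M. Apostol, *Modular functions and Dirichlet series in number theory*, GTM 41,
§3.1–§3.2 [cite: Apostol1990, §3.1–§3.2].
-/

set_option autoImplicit false
set_option linter.dupNamespace false

open PowerSeries Literature.NumberTheory.EllipticCurves.ModularForms

namespace Summit.BirchSwinnertonDyer.BirchSwinnertonDyer.Theorems.ManinLocalTwoThree

noncomputable section

/-! ### §1  Cubes in `𝔽₃⟦q⟧` live in `𝔽₃⟦q³⟧` -/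

section CharThree

/-- In `(ZMod 3)⟦X⟧` a cube has vanishing coefficients in the degrees prime to `3` (`(Σ aᵢqⁱ)³ = Σ aᵢ³q³ⁱ`): truncate the cube
root to a polynomial `t` of degree `≤ n` (`h ≡ t`, hence `h³ ≡ t³ (mod X^{n+1})`) and use `t³ = expand 3 t` over `𝔽₃`. [folklore] -/
theorem coeff_eq_zero_of_isCube_of_not_three_dvd {f : PowerSeries (ZMod 3)} (hf : ∃ h : PowerSeries (ZMod 3), f = h ^ 3)
    {n : ℕ} (hn : ¬ 3 ∣ n) : coeff n f = 0 := by
  obtain ⟨h, rfl⟩ := hf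
  set t : Polynomial (ZMod 3) := PowerSeries.trunc (n + 1) h with ht
  have hdvd : (X : PowerSeries (ZMod 3)) ^ (n + 1) ∣ h - (t : PowerSeries (ZMod 3)) := by
    rw [PowerSeries.X_pow_dvd_iff]
    intro m hm
    rw [map_sub, Polynomial.coeff_coe, ht, PowerSeries.coeff_trunc, if_pos hm, sub_self]
  have hdvd3 : (X : PowerSeries (ZMod 3)) ^ (n + 1) ∣ h ^ 3 - (t : PowerSeries (ZMod 3)) ^ 3 := by
    have e : h ^ 3 - (t : PowerSeries (ZMod 3)) ^ 3 =
        (h - (t : PowerSeries (ZMod 3))) * (h ^ 2 + h * (t : PowerSeries (ZMod 3)) + (t : PowerSeries (ZMod 3)) ^ 2) := by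
      ring
    rw [e]
    exact Dvd.dvd.mul_right hdvd _
  have hcoeff : coeff n (h ^ 3) = coeff n ((t : PowerSeries (ZMod 3)) ^ 3) := by
    have := (PowerSeries.X_pow_dvd_iff.mp hdvd3) n (Nat.lt_succ_self n)
    rwa [map_sub, sub_eq_zero] at this
  rw [hcoeff, ← Polynomial.coe_pow, Polynomial.coeff_coe, ← ZMod.expand_card, Polynomial.coeff_expand (by norm_num),
    if_neg hn]

end CharThree

/-! ### §2  The Euler factors `E(q^δ)` modulo `3` -/

section Euler

/-- `E(q^δ) mod 3`: constant term `1`. [folklore] -/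
theorem constantCoeff_formalEulerScaled_map_three (δ : ℕ) :
    constantCoeff ((formalEulerScaled δ).map (Int.castRingHom (ZMod 3))) = 1 := by
  rw [← coeff_zero_eq_constantCoeff_apply, coeff_map, coeff_zero_eq_constantCoeff_apply, constantCoeff_formalEulerScaled,
    map_one]

/-- `E(q^δ) mod 3` has no terms in degrees not divisible by `δ`. [folklore] -/
theorem coeff_formalEulerScaled_map_three_of_not_dvd {δ i : ℕ} (h : ¬ δ ∣ i) :
    coeff i ((formalEulerScaled δ).map (Int.castRingHom (ZMod 3))) = 0 := by
  rw [coeff_map, coeff_formalEulerScaled, if_neg h, map_zero]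

/-- `E(q^δ) mod 3` has coefficient `−1` in degree `δ ≥ 1`. [folklore] -/
theorem coeff_self_formalEulerScaled_map_three {δ : ℕ} (hδ : 0 < δ) :
    coeff δ ((formalEulerScaled δ).map (Int.castRingHom (ZMod 3))) = -1 := by
  rw [coeff_map, coeff_formalEulerScaled, if_pos dvd_rfl, Nat.div_self hδ, coeff_one_formalEulerPow_one, map_neg, map_one]

end Euler

/-! ### §3  Scales prime to `3`: a `3`-adic cube has exponents divisible by `3` there -/

section PrimeToThree

/-- `3 ∣ z ⟹ 3 ∣ z⁺` (plumbing). [folklore] -/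
theorem three_dvd_toNat {z : ℤ} (hz : (3 : ℤ) ∣ z) : 3 ∣ z.toNat := by
  rcases le_or_gt 0 z with h0 | h0
  · have : ((z.toNat : ℕ) : ℤ) = z := Int.toNat_of_nonneg h0
    exact Int.natCast_dvd_natCast.mp (by rw [this]; exact_mod_cast hz)
  · rw [Int.toNat_eq_zero.mpr h0.le]; exact dvd_zero 3

/-- **E-an-56, prime-to-`3` half**: let `0 ∉ S` and let `g ∈ 1 + qℤ⟦q⟧` satisfy the `η`-unit-series identity
`g · ∏_δ E(q^δ)^{(−r_δ)⁺} = ∏_δ E(q^δ)^{(r_δ)⁺}` (an's `IsEtaUnitSeries S r g`, unfolded).  If `g` is a cube in `ℤ₃⟦q⟧` then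
`3 ∣ r_δ` for every `δ ∈ S` prime to `3`. [cite: Apostol1990, §3.1–§3.2 (η(τ) = e^{πiτ/12}∏(1 − e^{2πinτ}); integrality of the product expansion)] -/
theorem three_dvd_of_isCube_etaUnit_of_not_three_dvd (S : Finset ℕ) (r : ℕ → ℤ) (g : PowerSeries ℤ) (hS : 0 ∉ S)
    (hg : constantCoeff g = 1 ∧
      g * ∏ δ ∈ S, formalEulerScaled δ ^ (-(r δ)).toNat = ∏ δ ∈ S, formalEulerScaled δ ^ (r δ).toNat)
    (hcube : ∃ h : PowerSeries ℤ_[3], g.map (Int.castRingHom ℤ_[3]) = h ^ 3) :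
    ∀ δ ∈ S, ¬ 3 ∣ δ → (3 : ℤ) ∣ r δ := by
  classical
  by_contra hex
  push Not at hex
  -- the least `δ` prime to `3` with `3 ∤ r_δ`
  let T : Finset ℕ := S.filter fun δ => ¬ 3 ∣ δ ∧ ¬ (3 : ℤ) ∣ r δ
  have hTne : T.Nonempty := by
    obtain ⟨δ, hδS, hδ, hr⟩ := hex
    exact ⟨δ, Finset.mem_filter.mpr ⟨hδS, hδ, hr⟩⟩
  set δ₀ := T.min' hTne with hδ₀def
  have hδ₀T : δ₀ ∈ T := Finset.min'_mem T hTne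
  obtain ⟨hδ₀S, hδ₀3, hr₀3⟩ := Finset.mem_filter.mp hδ₀T
  have hmin : ∀ δ ∈ S, ¬ 3 ∣ δ → ¬ (3 : ℤ) ∣ r δ → δ₀ ≤ δ :=
    fun δ hδ h1 h2 => Finset.min'_le T δ (Finset.mem_filter.mpr ⟨hδ, h1, h2⟩)
  -- reduce modulo `3`
  let π : ℤ →+* ZMod 3 := Int.castRingHom (ZMod 3)
  let e : ℕ → PowerSeries (ZMod 3) := fun δ => (formalEulerScaled δ).map π
  let gb : PowerSeries (ZMod 3) := g.map π
  have hgb_cube : ∃ hb : PowerSeries (ZMod 3), gb = hb ^ 3 := by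
    obtain ⟨h, hh⟩ := hcube
    refine ⟨h.map (PadicInt.toZMod (p := 3)), ?_⟩
    have e1 : gb = (g.map (Int.castRingHom ℤ_[3])).map (PadicInt.toZMod (p := 3)) := by
      have hc : ((PadicInt.toZMod (p := 3)).comp (Int.castRingHom ℤ_[3])) = π := RingHom.ext_int _ _
      have := congrArg (fun φ : ℤ →+* ZMod 3 => PowerSeries.map φ g) hc
      change PowerSeries.map ((PadicInt.toZMod (p := 3)).comp (Int.castRingHom ℤ_[3])) g = PowerSeries.map π g at this
      show PowerSeries.map π g = _
      rw [← this, PowerSeries.map_comp]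
      rfl
    rw [e1, hh, map_pow]
  have hid : gb * ∏ δ ∈ S, e δ ^ (-(r δ)).toNat = ∏ δ ∈ S, e δ ^ (r δ).toNat := by
    have := congrArg (PowerSeries.map π) hg.2
    simpa only [map_mul, map_prod, map_pow] using this
  -- the functional `c = coeff δ₀` and the vanishing predicate, factor by factor
  have hfac : ∀ δ ∈ S, ∀ n : ℕ, (¬ (3 : ℤ) ∣ r δ ∨ 3 ∣ n) →
      constantCoeff (e δ ^ n) = 1 ∧ (∀ i, ¬ 3 ∣ i → i < δ₀ → coeff i (e δ ^ n) = 0) ∧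
        coeff δ₀ (e δ ^ n) = if δ = δ₀ then -(n : ZMod 3) else 0 := by
    intro δ hδS n hn
    have hδ0 : 0 < δ := Nat.pos_of_ne_zero (fun h => hS (h ▸ hδS))
    by_cases hA : ∀ i, ¬ 3 ∣ i → i < δ₀ → coeff i (e δ) = 0
    · -- `e δ` itself is admissible: `3 ∣ δ`, or `δ ≥ δ₀`
      obtain ⟨h0, hA', hc⟩ := coeff_pow_of_vanishThreeBelow hδ₀3 (constantCoeff_formalEulerScaled_map_three δ) hA n
      refine ⟨h0, hA', ?_⟩
      rw [hc]
      by_cases hδδ : δ = δ₀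
      · subst hδδ
        rw [if_pos rfl, coeff_self_formalEulerScaled_map_three hδ0, nsmul_eq_mul, mul_neg, mul_one]
      · rw [if_neg hδδ]
        have hnd : ¬ δ ∣ δ₀ := by
          intro hd
          by_cases h3δ : 3 ∣ δ
          · exact hδ₀3 (h3δ.trans hd)
          · -- `3 ∤ δ`, `δ ∣ δ₀`, `δ ≠ δ₀`: then `δ < δ₀`, and `e δ` would have the coefficient `coeff δ = -1 ≠ 0`
            have hlt : δ < δ₀ := lt_of_le_of_ne (Nat.le_of_dvd (Nat.pos_of_ne_zero fun h => hS (h ▸ hδ₀S)) hd) hδδ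
            have := hA δ h3δ hlt
            rw [coeff_self_formalEulerScaled_map_three hδ0] at this
            exact absurd this (by decide)
        rw [coeff_formalEulerScaled_map_three_of_not_dvd hnd, smul_zero]
    · -- `e δ` is NOT admissible: then `3 ∤ δ` and `δ < δ₀`, so `3 ∣ r δ`, so `3 ∣ n` and `e δ ^ n` is a cube
      have hδ3 : ¬ 3 ∣ δ := by
        intro h3
        apply hA; intro i hi _
        exact coeff_formalEulerScaled_map_three_of_not_dvd fun hd => hi (h3.trans hd)
      have hlt : δ < δ₀ := by
        by_contra hle
        apply hA; intro i hi hiδ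
        exact coeff_formalEulerScaled_map_three_of_not_dvd fun hd => by
          have := Nat.le_of_dvd (Nat.pos_of_ne_zero (by rintro rfl; exact hi (dvd_zero 3))) hd; omega
      have hr3 : (3 : ℤ) ∣ r δ := by
        by_contra hro
        exact absurd (hmin δ hδS hδ3 hro) (not_le.mpr hlt)
      have hn3 : 3 ∣ n := hn.resolve_left (not_not.mpr hr3)
      obtain ⟨k, rfl⟩ := hn3
      have hcb : ∃ hb : PowerSeries (ZMod 3), e δ ^ (3 * k) = hb ^ 3 := ⟨e δ ^ k, by rw [mul_comm, pow_mul]⟩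
      refine ⟨?_, fun i hi _ => coeff_eq_zero_of_isCube_of_not_three_dvd hcb hi, ?_⟩
      · rw [map_pow, constantCoeff_formalEulerScaled_map_three, one_pow]
      · rw [coeff_eq_zero_of_isCube_of_not_three_dvd hcb hδ₀3]
        have hne : δ ≠ δ₀ := fun h => hr₀3 (h ▸ hr3)
        rw [if_neg hne]
  -- divisibility of the exponents `(± r δ)⁺`
  have hparR : ∀ δ, ¬ (3 : ℤ) ∣ r δ ∨ 3 ∣ (r δ).toNat := fun δ => by
    by_cases h : (3 : ℤ) ∣ r δ
    · exact Or.inr (three_dvd_toNat h)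
    · exact Or.inl h
  have hparL : ∀ δ, ¬ (3 : ℤ) ∣ r δ ∨ 3 ∣ (-(r δ)).toNat := fun δ => by
    by_cases h : (3 : ℤ) ∣ r δ
    · exact Or.inr (three_dvd_toNat h.neg_right)
    · exact Or.inl h
  -- apply the functional to both sides of the identity
  obtain ⟨hL0, hLA, hLc⟩ := coeff_prod_of_vanishThreeBelow hδ₀3 S (fun δ => e δ ^ (-(r δ)).toNat)
    (fun δ hδ => (hfac δ hδ _ (hparL δ)).1) (fun δ hδ => (hfac δ hδ _ (hparL δ)).2.1)
  obtain ⟨-, -, hRc⟩ := coeff_prod_of_vanishThreeBelow hδ₀3 S (fun δ => e δ ^ (r δ).toNat)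
    (fun δ hδ => (hfac δ hδ _ (hparR δ)).1) (fun δ hδ => (hfac δ hδ _ (hparR δ)).2.1)
  have hgbA : ∀ i, ¬ 3 ∣ i → i < δ₀ → coeff i gb = 0 := fun i hi _ => coeff_eq_zero_of_isCube_of_not_three_dvd hgb_cube hi
  have hgbc : coeff δ₀ gb = 0 := coeff_eq_zero_of_isCube_of_not_three_dvd hgb_cube hδ₀3
  have hgb0 : constantCoeff gb = 1 := by
    show constantCoeff (g.map π) = 1
    rw [← coeff_zero_eq_constantCoeff_apply, coeff_map, coeff_zero_eq_constantCoeff_apply, hg.1, map_one]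
  obtain ⟨-, hc⟩ := coeff_mul_of_vanishThreeBelow hδ₀3 hgbA hLA
  rw [hid, hRc, hgbc, hgb0, hL0, zero_mul, one_mul, zero_add, hLc,
    Finset.sum_congr rfl (fun δ hδ => (hfac δ hδ _ (hparR δ)).2.2),
    Finset.sum_congr rfl (fun δ hδ => (hfac δ hδ _ (hparL δ)).2.2), Finset.sum_ite_eq', Finset.sum_ite_eq',
    if_pos hδ₀S, if_pos hδ₀S, neg_inj] at hc
  -- `hc : ((r δ₀)⁺ : 𝔽₃) = ((−r δ₀)⁺ : 𝔽₃)`; one side is `0`, the other is `|r δ₀| ≢ 0 (mod 3)`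
  have habs : ¬ 3 ∣ (r δ₀).natAbs := fun h => hr₀3 (Int.ofNat_dvd_left.mpr h)
  rcases le_or_gt 0 (r δ₀) with h0 | h0
  · have hL : (-(r δ₀)).toNat = 0 := Int.toNat_eq_zero.mpr (by omega)
    have hR : (r δ₀).toNat = (r δ₀).natAbs := by omega
    rw [hL, hR, Nat.cast_zero] at hc
    exact habs ((ZMod.natCast_eq_zero_iff _ 3).mp hc)
  · have hR : (r δ₀).toNat = 0 := Int.toNat_eq_zero.mpr h0.le
    have hL : (-(r δ₀)).toNat = (r δ₀).natAbs := by omega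
    rw [hL, hR, Nat.cast_zero] at hc
    exact habs ((ZMod.natCast_eq_zero_iff _ 3).mp hc.symm)

end PrimeToThree

end

end Summit.BirchSwinnertonDyer.BirchSwinnertonDyer.Theorems.ManinLocalTwoThree
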